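import Summits.BirchSwinnertonDyer.Rank1Residual.Additive.X3BranchResidualLineH1LowerBound
import HarnessLib

/-!
# X3, the DEGENERATE rows OFF the sub-locus: classes of `H¹(H, Φ₀)` from additive characters of an
# OPEN SUBGROUP `G' ⊇ H` (trivial action) — the class, the conjugation formula, local vanishing
# (cell `bsd-eis`, seat `bsd-eis-x3` gen 7; second brick of the T-side over the first layer `ℚ_1`
# (MEMO-9 §2.4 (f)), companion of `X3BranchKummerLayerTwisted.lean`; route K1 `AdditiveBranchIMC`,
# crux `GordTwoRankZeroOffCaseOne` — supports only)

HONEST FRAMING (`run/shared/lean/pub/bsd-eis/README.md` §4): THEOREMS ONLY (no `def`, no named fact,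
no `sorry`); nothing is booked; no label, tier or count of record moves.

## What

`X3BranchResidualLineH1LowerBound.lean` (gen 6, namespace `TrivialLineClasses`) turns a continuous
ADDITIVE CHARACTER OF `Γ_K` into a class of `H¹(H, Φ)` (`Φ` with trivial action), proves that
conjugation fixes it and that it is unramified where the character vanishes on inertia. The T-side
classes over the first layer are characters of the LAYER GROUP `G₁` only
(`KummerLayerTwisted.exists_twistedKummerChar`), and conjugation by `σ ∉ G₁` moves them. This file is
the `G'`-version: for `χ : Γ_K → Φ` additive on a NORMAL subgroup `G' ⊇ H`,
* `exists_class_of_addCharOn` — the class `[χ|_H]` with its cocycle `h ↦ χ(h)`;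
* `conjH1_eq_of_addCharOn` — `conj_σ[χ|_H] = [χ^σ|_H]`, `χ^σ(g) = χ(σ⁻¹ g σ)` (again additive on `G'`);
* `mem_unramifiedOutside_of_addCharOn` — `[χ|_H] ∈ H¹(K_Σ/L, Φ)` (`unramifiedOutside H Φ p S₀`) as
  soon as `χ(σ⁻¹τσ) = 0` for every `σ ∈ Γ_K`, every finite `v ∉ S₀`, `v ∤ p`, and every `τ ∈ I_v`
  — i.e. `χ` vanishes on ALL conjugates of the inertia groups away from `S₀ ∪ {p}` (for the layer
  characters: at every place of `ℚ_1` above such `v`).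
References: [SerreGaloisCohomology1997] I.§2.5, I.§5.8; [GreenbergVatsal2000] §2 pp. 16, 23, 28.
-/

set_option autoImplicit false

noncomputable section

open scoped Classical AddSubgroup

namespace Summit.BirchSwinnertonDyer.Rank1Residual.Additive

open NumberField IsDedekindDomain Field
  Literature.NumberTheory.GaloisRepresentations
  Literature.NumberTheory.EllipticCurves
  Literature.NumberTheory.EllipticCurves.GreenbergSelmer
  Literature.NumberTheory.EllipticCurves.GreenbergVatsal2000
  Literature.NumberTheory.EllipticCurves.Rank1Residual
  TrivialLineClasses

universe u

namespace LayerAddChar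

variable {K : Type u} [Field K] [NumberField K] (H : Subgroup (absoluteGaloisGroup K)) [H.Normal]
  {Φ : Type u} [AddCommGroup Φ] [DistribMulAction (absoluteGaloisGroup K) Φ]
  [TopologicalSpace Φ] [DiscreteTopology Φ]

omit [NumberField K] [H.Normal] in
/-- **The class `[χ|_H] ∈ H¹(H, Φ)` of a continuous map `χ : Γ_K → Φ` ADDITIVE ON A SUBGROUP
`G' ⊇ H`** (trivial action): an existence statement recording its cocycle `h ↦ χ(h)`
(`cocycleOf`, `H1TrivialAction`). [folklore] -/
theorem exists_class_of_addCharOn (htriv : ∀ (σ : absoluteGaloisGroup K) (x : Φ), σ • x = x)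
    {G' : Subgroup (absoluteGaloisGroup K)} (hHG : H ≤ G')
    (χ : absoluteGaloisGroup K → Φ) (hχ : ∀ a ∈ G', ∀ b ∈ G', χ (a * b) = χ a + χ b)
    (hc : Continuous χ) :
    ∃ c : subgroupH1 H Φ, ∀ h : H,
      (cocycleOf H Φ (subgroup_smul_eq_self_of_trivial H htriv) c).1 h = χ h := by
  have htrivH := subgroup_smul_eq_self_of_trivial H htriv
  refine ⟨oneCocycleClass (discreteTopRep H Φ)
    (homCocycle htrivH (fun h : H ↦ χ h) (fun a b ↦ by
        rw [Subgroup.coe_mul, hχ _ (hHG a.2) _ (hHG b.2)])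
      (hc.comp continuous_subtype_val)), fun h ↦ ?_⟩
  rw [cocycleOf_oneCocycleClass]
  rfl

omit [NumberField K] in
/-- **The conjugation formula**: for `χ` additive on `G' ⊇ H` and `σ ∈ Γ_K`,
`conj_σ [χ|_H] = [χ^σ|_H]` where `χ^σ(g) = χ(σ⁻¹ g σ)` — pointwise `(σ·f)(h) = σ • f(σ⁻¹hσ) = χ(σ⁻¹hσ)`.
Here `c'` is any class whose cocycle is `h ↦ χ(σ⁻¹hσ)`. [cite: SerreGaloisCohomology1997, I.§5.8] -/
theorem conjH1_eq_of_addCharOn (htriv : ∀ (σ : absoluteGaloisGroup K) (x : Φ), σ • x = x)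
    (χ : absoluteGaloisGroup K → Φ) (σ : absoluteGaloisGroup K) (c c' : subgroupH1 H Φ)
    (hcχ : ∀ h : H, (cocycleOf H Φ (subgroup_smul_eq_self_of_trivial H htriv) c).1 h = χ h)
    (hc'χ : ∀ h : H, (cocycleOf H Φ (subgroup_smul_eq_self_of_trivial H htriv) c').1 h =
      χ (σ⁻¹ * h * σ)) :
    conjH1 H Φ σ c = c' := by
  have htrivH := subgroup_smul_eq_self_of_trivial H htriv
  set f := cocycleOf H Φ htrivH c with hf
  set f' := cocycleOf H Φ htrivH c' with hf'
  have hc : c = oneCocycleClass (discreteTopRep H Φ) f := (oneCocycleClass_cocycleOf htrivH c).symm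
  have hc' : c' = oneCocycleClass (discreteTopRep H Φ) f' :=
    (oneCocycleClass_cocycleOf htrivH c').symm
  rw [hc, hc']
  change resH1Hom (subgroupConj H σ) (DistribSMul.toAddMonoidHom Φ σ) _
    (oneCocycleClass (discreteTopRep H Φ) f) = _
  unfold resH1Hom
  change (ContinuousCohomology.map (subgroupConj H σ) _ 1).hom
    (oneCocycleClass (discreteTopRep H Φ) f) = _
  rw [map_oneCocycleClass]
  congr 1
  refine Subtype.ext (ContinuousMap.ext fun h ↦ ?_)
  rw [contOneCocycles.pullback_apply]
  change σ • f.1 (subgroupConj H σ h) = f'.1 h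
  rw [htriv, hcχ, hc'χ, subgroupConj_apply_coe]

/-- **A `G'`-character class unramified away from `S₀ ∪ {p}` lies in `H¹(K_Σ/L, Φ)`**
(`unramifiedOutside H Φ p S₀`), `G'` NORMAL, `H ≤ G'`: for every `σ` the conjugate class is the class
of `χ^σ` (`conjH1_eq_of_addCharOn`), which vanishes on `I_v ∩ H` when `χ(σ⁻¹τσ) = 0` for all
`τ ∈ I_v` (`TrivialLineClasses.mem_unramifiedKer_of_addChar`; for the layer characters `I_v ≤ G₁`
at every `v ∤ 3`, so the hypothesis is about values of `χ` on `G₁` only).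
[cite: GreenbergVatsal2000, §2 pp. 16, 23, 28] -/
theorem mem_unramifiedOutside_of_addCharOn
    (htriv : ∀ (σ : absoluteGaloisGroup K) (x : Φ), σ • x = x)
    {G' : Subgroup (absoluteGaloisGroup K)} [G'.Normal] (hHG : H ≤ G')
    (χ : absoluteGaloisGroup K → Φ) (hχ : ∀ a ∈ G', ∀ b ∈ G', χ (a * b) = χ a + χ b)
    (hcont : Continuous χ) (c : subgroupH1 H Φ)
    (hcχ : ∀ h : H, (cocycleOf H Φ (subgroup_smul_eq_self_of_trivial H htriv) c).1 h = χ h)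
    (p : ℕ) (S₀ : Set (HeightOneSpectrum (𝓞 K)))
    (hv : ∀ v : HeightOneSpectrum (𝓞 K), v ∉ S₀ → ((p : ℕ) : 𝓞 K) ∉ v.asIdeal →
      ∀ σ : absoluteGaloisGroup K, ∀ τ ∈ inertia v, χ (σ⁻¹ * τ * σ) = 0) :
    c ∈ unramifiedOutside H Φ p S₀ := by
  rw [mem_unramifiedOutside_iff]
  intro v hvS hvp σ
  -- the conjugate character `χ^σ`, additive on `G'` (normal) and continuous
  have hχσ : ∀ a ∈ G', ∀ b ∈ G', χ (σ⁻¹ * (a * b) * σ) = χ (σ⁻¹ * a * σ) + χ (σ⁻¹ * b * σ) := by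
    intro a ha b hb
    have ha' : σ⁻¹ * a * σ ∈ G' := by
      have := Subgroup.Normal.conj_mem inferInstance a ha σ⁻¹
      simpa using this
    have hb' : σ⁻¹ * b * σ ∈ G' := by
      have := Subgroup.Normal.conj_mem inferInstance b hb σ⁻¹
      simpa using this
    rw [show σ⁻¹ * (a * b) * σ = σ⁻¹ * a * σ * (σ⁻¹ * b * σ) by group, hχ _ ha' _ hb']
  have hcontσ : Continuous fun g : absoluteGaloisGroup K ↦ χ (σ⁻¹ * g * σ) :=
    hcont.comp ((continuous_const.mul continuous_id).mul continuous_const)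
  obtain ⟨c', hc'⟩ := exists_class_of_addCharOn H htriv hHG (fun g ↦ χ (σ⁻¹ * g * σ)) hχσ hcontσ
  rw [conjH1_eq_of_addCharOn H htriv χ σ c c' hcχ hc']
  exact mem_unramifiedKer_of_addChar H htriv (fun g ↦ χ (σ⁻¹ * g * σ)) c' hc' v (hv v hvS hvp σ)

end LayerAddChar

end Summit.BirchSwinnertonDyer.Rank1Residual.Additive

end
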